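import Summits.BirchSwinnertonDyer.BirchSwinnertonDyer.Theorems.ByReductionTypeAtTwoSupersingularFlatKernelCyclicOfQuotientDual
import Literature.Algebra.Module.PadicPairingFamilies
import Literature.NumberTheory.IwasawaTheory.PruferPontryaginDual
import Mathlib.RingTheory.PowerSeries.Trunc
import HarnessLib

/-!
# Route `ByReductionTypeAtTwo` (rung K4), crux `SupersingularRankZeroAtTwo` (item stmt-BirchSwinnertonDyer-19097), stub 5
# `stub_flatKernelCyclic` (hand h13), sub-hand h13b: **PONTRYAGIN BIDUALITY FOR `Λ = ℤ_p⟦T⟧`** — the character group of the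
# discrete dual `Λ^∨ = lim→ Hom(Λ/(T^n, p^k), ℚ/ℤ)` is `Λ` itself (every character of `Λ^∨` is «evaluate at `f`»), hence the
# `Λ`-module `Hom(Λ^∨, ℚ/ℤ)` (tree structure `IwasawaDual.IsLocNil.module`, `T ↦ ∘ (T·)`) is CYCLIC, generated by «evaluate at 1»;
# and cyclicity TRANSFERS along equivariant injections `Q ↪ Λ^∨` (pure algebra; cell `bsd-2adic`, seat `bsd-2adic-t42` GEN 44;
# `--supports 19097`, helper; sequel of `…FlatKernelCyclicOfQuotientDual`)

HONEST FRAMING (D-0036/D-0054): THEOREMS ONLY (no definition, no named fact, no `sorry`, no instance).  The discrete dual `Λ^∨` is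
NOT defined: it is any subgroup `Q ≤ Hom(Λ, ℚ/ℤ)` satisfying the membership criterion `hQ` («kills `T^n Λ` and `p^k Λ` for some
`n, k`»), which exists (`exists_dualLambda`); its shift `ψ` (`χ ↦ χ ∘ (T·)`) is any endomorphism satisfying `hψ` (exists,
`exists_dualLambda_shift`).  WHY (h13b after `…FlatKernelCyclicOfQuotientDual`): `ker(X ↠ X♭)` is cyclic iff-ish the character module of
`Sel_∞ ⧸ Sel♭` is cyclic; the Kummer pairing against `z♭` (h13a: `Ker Col♭ = Λ ∙ z♭`) is an equivariant injection `Sel_∞ ⧸ Sel♭ ↪ Λ^∨`;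
this file supplies the two algebraic facts turning such an injection into cyclicity — biduality of `Λ` and the transfer.  The injection
itself (arithmetic) is NOT constructed here.  19097 OPEN; nothing booked; BSD proved for no curve.

* §1 `exists_dualLambda`, `exists_dualLambda_shift`, `isLocNil_dualLambda` — the discrete dual and its shift; `(p, ψ)` locally nilpotent.
* §2 `apply_eq_sum_of_forall_X_pow_mul` (a character killing `T^n Λ` is determined by `f mod T^n`: `χ f = ∑_{i<n} χ (C (coeff i f) T^i)`),
  `apply_C_mul_eq_val_nsmul` (a character killing `p^k Λ` sees constants through `ℤ_p → ℤ/p^k`).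
* §3 **`exists_eq_eval_of_character_dualLambda`** — BIDUALITY: every additive `y : Λ^∨ → ℚ/ℤ` is `χ ↦ χ(f)` for some `f ∈ Λ`
  (coefficients `c_i ∈ ℤ_p` assembled from the residues of `y` on the coefficient characters `g ↦ coeff_i(g)/p^k` by the tree's
  biduality `(ℤ ⊗ ℚ_p/ℤ_p)^∨ = ℤ_p` — `Literature.Algebra.Module.exists_eval_eq_of_character_padicPairingFamily` with `N = ℤ`).
* §4 `smul_evalOne_eq_eval` (`f • ev₁ = ev_f` for `IsLocNil.module`), **`exists_cyclic_characterModule_dualLambda`** (`Hom(Λ^∨, ℚ/ℤ) = Λ ∙ ev₁`).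
* §5 **`exists_cyclic_characterModule_of_injective`** — TRANSFER: `(S, ψ_S) ↪ (Q, ψ_Q)` equivariant injective and `Hom(Q, ℚ/ℤ)` cyclic
  ⟹ `Hom(S, ℚ/ℤ)` cyclic (ℚ/ℤ injective: Mathlib `CharacterModule.dual_surjective_of_injective`; precomposition is `Λ`-linear).

References: [NeukirchSchmidtWingberg2008] I §1 (1.1.8) (Pontryagin duality); [Lang1990] Ch. 5 §1 (`Λ = lim ℤ_p[T]/(T^n, p^k)`);
[GreenbergLNM1716] §1 p. 60; [KitajimaOtsuki2018] Prop. 3.32; tree `Literature/Algebra/Module/PadicPairingFamilies.lean` (ss-1 GEN 13),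
`IwasawaDualModule`, p823268, p824689.
-/

set_option autoImplicit false
-- the Theorems namespace of this sub repeats the summit name by design (D-0017 nested layout)
set_option linter.dupNamespace false

noncomputable section

open scoped Classical
open Finset PowerSeries

namespace Summit.BirchSwinnertonDyer.BirchSwinnertonDyer.Theorems

namespace OddBlindNF

namespace LambdaDual

open Literature.NumberTheory.EllipticCurves Literature.NumberTheory.EllipticCurves.IwasawaDual Literature.Algebra.Module

variable {p : ℕ} [hp : Fact p.Prime]

/-! ### §0 Classes `a / p^k` in `ℚ/ℤ` (folklore casts) -/

omit hp in
/-- `m • (a/p^k) = (m a)/p^k` in `ℚ/ℤ`. [folklore] -/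
theorem nsmul_coe_div_pow (k m : ℕ) (a : ℤ) :
    m • ((((a : ℚ) / (p : ℚ) ^ k : ℚ)) : AddCircle (1 : ℚ)) = ((((m * a : ℤ) : ℚ) / (p : ℚ) ^ k : ℚ) : AddCircle (1 : ℚ)) := by
  rw [← AddCircle.coe_nsmul, nsmul_eq_mul, ← mul_div_assoc]
  push_cast
  rfl

omit hp in
/-- `b • (a/p^k) = (b a)/p^k` in `ℚ/ℤ` (integer multiple). [folklore] -/
theorem zsmul_coe_div_pow (k : ℕ) (b a : ℤ) :
    b • ((((a : ℚ) / (p : ℚ) ^ k : ℚ)) : AddCircle (1 : ℚ)) = ((((b * a : ℤ) : ℚ) / (p : ℚ) ^ k : ℚ) : AddCircle (1 : ℚ)) := by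
  rw [← AddCircle.coe_zsmul, zsmul_eq_mul, ← mul_div_assoc]
  push_cast
  rfl

/-! ### §1 The discrete dual `Λ^∨` (by its membership criterion) and its shift -/

/-- **The discrete dual of `Λ = ℤ_p⟦T⟧` exists**: the characters of `(Λ, +)` killing `T^n Λ` and `p^k Λ` for some `n, k` form a subgroup
of `Hom(Λ, ℚ/ℤ)` (`= lim→ Hom(Λ/(T^n, p^k), ℚ/ℤ)`, the Pontryagin dual of the compact ring `Λ`). [cite: Lang1990, Ch. 5 §1]
[cite: NeukirchSchmidtWingberg2008, I §1 (1.1.8)] -/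
theorem exists_dualLambda :
    ∃ Q : AddSubgroup (PowerSeries ℤ_[p] →+ AddCircle (1 : ℚ)), ∀ χ, χ ∈ Q ↔
      ∃ n k : ℕ, (∀ f, χ (X ^ n * f) = 0) ∧ (∀ f, χ ((p : PowerSeries ℤ_[p]) ^ k * f) = 0) := by
  refine ⟨{ carrier := {χ | ∃ n k : ℕ, (∀ f, χ (X ^ n * f) = 0) ∧ (∀ f, χ ((p : PowerSeries ℤ_[p]) ^ k * f) = 0)}
            zero_mem' := ⟨0, 0, fun f ↦ rfl, fun f ↦ rfl⟩
            add_mem' := ?_, neg_mem' := ?_ }, fun χ ↦ Iff.rfl⟩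
  · rintro χ χ' ⟨n, k, hn, hk⟩ ⟨n', k', hn', hk'⟩
    refine ⟨n + n', k + k', fun f ↦ ?_, fun f ↦ ?_⟩
    · rw [AddMonoidHom.add_apply, pow_add, mul_assoc, hn, mul_comm (X ^ n), mul_assoc, hn', add_zero]
    · rw [AddMonoidHom.add_apply, pow_add, mul_assoc, hk, mul_comm ((p : PowerSeries ℤ_[p]) ^ k), mul_assoc, hk', add_zero]
  · rintro χ ⟨n, k, hn, hk⟩
    exact ⟨n, k, fun f ↦ by rw [AddMonoidHom.neg_apply, hn, neg_zero], fun f ↦ by rw [AddMonoidHom.neg_apply, hk, neg_zero]⟩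

variable {Q : AddSubgroup (PowerSeries ℤ_[p] →+ AddCircle (1 : ℚ))}

/-- **The shift `ψ : χ ↦ χ ∘ (T·)` of the discrete dual exists** (it preserves the membership criterion). [cite: Lang1990, Ch. 5 §1] -/
theorem exists_dualLambda_shift
    (hQ : ∀ χ, χ ∈ Q ↔ ∃ n k : ℕ, (∀ f, χ (X ^ n * f) = 0) ∧ (∀ f, χ ((p : PowerSeries ℤ_[p]) ^ k * f) = 0)) :
    ∃ ψ : AddMonoid.End Q, ∀ χ : Q,
      ((ψ χ : Q) : PowerSeries ℤ_[p] →+ AddCircle (1 : ℚ)) = (χ : PowerSeries ℤ_[p] →+ AddCircle (1 : ℚ)).comp (AddMonoidHom.mulLeft X) := by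
  have hmem : ∀ χ : Q, (χ : PowerSeries ℤ_[p] →+ AddCircle (1 : ℚ)).comp (AddMonoidHom.mulLeft X) ∈ Q := by
    intro χ
    obtain ⟨n, k, hn, hk⟩ := (hQ χ).mp χ.2
    refine (hQ _).mpr ⟨n, k, fun f ↦ ?_, fun f ↦ ?_⟩
    · rw [AddMonoidHom.comp_apply, AddMonoidHom.coe_mulLeft, ← mul_assoc, mul_comm X, mul_assoc, hn]
    · rw [AddMonoidHom.comp_apply, AddMonoidHom.coe_mulLeft, ← mul_assoc, mul_comm X, mul_assoc, hk]
  refine ⟨{ toFun := fun χ ↦ ⟨_, hmem χ⟩, map_zero' := Subtype.ext (by ext f; rfl),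
            map_add' := fun χ χ' ↦ Subtype.ext (by ext f; rfl) }, fun χ ↦ rfl⟩

/-- The iterated shift: `ψ^i χ = χ ∘ (T^i ·)`. [folklore] -/
theorem coe_shift_pow_apply {ψ : AddMonoid.End Q}
    (hψ : ∀ χ : Q, ((ψ χ : Q) : PowerSeries ℤ_[p] →+ AddCircle (1 : ℚ)) =
      (χ : PowerSeries ℤ_[p] →+ AddCircle (1 : ℚ)).comp (AddMonoidHom.mulLeft X))
    (i : ℕ) (χ : Q) (f : PowerSeries ℤ_[p]) :
    (((ψ ^ i) χ : Q) : PowerSeries ℤ_[p] →+ AddCircle (1 : ℚ)) f = (χ : PowerSeries ℤ_[p] →+ AddCircle (1 : ℚ)) (X ^ i * f) := by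
  induction i generalizing f with
  | zero => rw [pow_zero, pow_zero, one_mul]; rfl
  | succ i ih =>
    rw [pow_succ', AddMonoid.End.coe_mul, Function.comp_apply, hψ, AddMonoidHom.comp_apply, AddMonoidHom.coe_mulLeft, ih,
      ← mul_assoc, ← pow_succ]

/-- **`(p, ψ)` is locally nilpotent on the discrete dual**: `p^k χ = 0` and `ψ^n χ = 0` for the `(n, k)` of the criterion.
[cite: GreenbergLNM1716, §1 p. 60 (after Conj. 1.3)] -/
theorem isLocNil_dualLambda
    (hQ : ∀ χ, χ ∈ Q ↔ ∃ n k : ℕ, (∀ f, χ (X ^ n * f) = 0) ∧ (∀ f, χ ((p : PowerSeries ℤ_[p]) ^ k * f) = 0))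
    {ψ : AddMonoid.End Q}
    (hψ : ∀ χ : Q, ((ψ χ : Q) : PowerSeries ℤ_[p] →+ AddCircle (1 : ℚ)) =
      (χ : PowerSeries ℤ_[p] →+ AddCircle (1 : ℚ)).comp (AddMonoidHom.mulLeft X)) :
    IsLocNil p ψ := by
  refine ⟨fun χ ↦ ?_, fun χ ↦ ?_⟩
  · obtain ⟨n, k, -, hk⟩ := (hQ χ).mp χ.2
    refine ⟨k, Subtype.ext ?_⟩
    ext f
    rw [AddSubgroupClass.coe_nsmul, AddMonoidHom.nsmul_apply, ← map_nsmul, nsmul_eq_mul, Nat.cast_pow, hk]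
    rfl
  · obtain ⟨n, k, hn, -⟩ := (hQ χ).mp χ.2
    refine ⟨n, Subtype.ext ?_⟩
    ext f
    rw [coe_shift_pow_apply hψ, hn]
    rfl

/-! ### §2 Characters killing `T^n Λ` / `p^k Λ` -/

/-- **A character killing `T^n Λ` is determined by `f mod T^n`**: `χ f = ∑_{i<n} χ (C (coeff_i f) · T^i)`. [folklore]
[cite: Lang1990, Ch. 5 §1] -/
theorem apply_eq_sum_of_forall_X_pow_mul (χ : PowerSeries ℤ_[p] →+ AddCircle (1 : ℚ)) :
    ∀ (n : ℕ), (∀ f, χ (X ^ n * f) = 0) → ∀ f : PowerSeries ℤ_[p],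
      χ f = ∑ i ∈ range n, χ (C (coeff i f) * X ^ i) := by
  intro n
  induction n generalizing χ with
  | zero =>
    intro hn f
    rw [Finset.sum_range_zero, ← one_mul f, ← pow_zero X, hn]
  | succ n ih =>
    intro hn f
    -- `f = T · g + C a₀`
    have hdec := eq_X_mul_shift_add_const f
    set g : PowerSeries ℤ_[p] := mk fun q => coeff (q + 1) f with hg
    let χ' : PowerSeries ℤ_[p] →+ AddCircle (1 : ℚ) := χ.comp (AddMonoidHom.mulLeft X)
    have hχ' : ∀ h, χ' (X ^ n * h) = 0 := fun h ↦ by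
      show χ (X * (X ^ n * h)) = 0
      rw [← mul_assoc, ← pow_succ', hn]
    have hg' := ih χ' hχ' g
    conv_lhs => rw [hdec]
    rw [map_add, Finset.sum_range_succ', pow_zero, mul_one, coeff_zero_eq_constantCoeff_apply]
    congr 1
    rw [show χ (X * g) = χ' g from rfl, hg']
    refine Finset.sum_congr rfl fun i _ ↦ ?_
    show χ (X * (C (coeff i g) * X ^ i)) = _
    rw [hg, coeff_mk, pow_succ', ← mul_assoc, mul_comm X (C _), mul_assoc]

/-- **A character killing `p^k Λ` sees the constants through `ℤ_p → ℤ/p^k`**: `χ (C c · g) = (c mod p^k) • χ g`.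
[cite: Lang1990, Ch. 5 §1] -/
theorem apply_C_mul_eq_val_nsmul (χ : PowerSeries ℤ_[p] →+ AddCircle (1 : ℚ)) {k : ℕ}
    (hk : ∀ f, χ ((p : PowerSeries ℤ_[p]) ^ k * f) = 0) (c : ℤ_[p]) (g : PowerSeries ℤ_[p]) :
    χ (C c * g) = (PadicInt.toZModPow k c).val • χ g := by
  -- `c = val + p^k d`
  have hker : c - ((PadicInt.toZModPow k c).val : ℤ_[p]) ∈ RingHom.ker (PadicInt.toZModPow k) := by
    rw [RingHom.mem_ker, map_sub, map_natCast, ZMod.natCast_zmod_val, sub_self]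
  rw [PadicInt.ker_toZModPow, Ideal.mem_span_singleton'] at hker
  obtain ⟨d, hd⟩ := hker
  have hc : C c = (((PadicInt.toZModPow k c).val : ℕ) : PowerSeries ℤ_[p]) + C d * (p : PowerSeries ℤ_[p]) ^ k := by
    rw [← map_natCast (C (R := ℤ_[p])) p, ← map_pow, ← map_mul, ← map_natCast (C (R := ℤ_[p])), ← map_add, hd]
    congr 1; ring
  rw [hc, add_mul, map_add, ← nsmul_eq_mul, map_nsmul, mul_comm (C d), mul_assoc, hk, add_zero]

/-- A character killing `p^k Λ` takes `p^k`-torsion values. [folklore] -/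
theorem nsmul_apply_eq_zero (χ : PowerSeries ℤ_[p] →+ AddCircle (1 : ℚ)) {k : ℕ}
    (hk : ∀ f, χ ((p : PowerSeries ℤ_[p]) ^ k * f) = 0) (g : PowerSeries ℤ_[p]) : p ^ k • χ g = 0 := by
  rw [← map_nsmul, nsmul_eq_mul, Nat.cast_pow, hk]

/-! ### §3 Biduality: every character of `Λ^∨` is an evaluation -/

/-- The additive map `Λ → Hom(ℤ, ℤ_p)`, `g ↦ (m ↦ m · coeff_i g)` (the `i`-th coefficient as a functional on `ℤ`). [folklore] -/
theorem exists_coeffFunctional (i : ℕ) :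
    ∃ α : PowerSeries ℤ_[p] →+ (ℤ →+ ℤ_[p]), ∀ (g : PowerSeries ℤ_[p]) (m : ℤ), α g m = m * coeff i g :=
  ⟨{ toFun := fun g ↦ (AddMonoidHom.mulRight (coeff i g)).comp (Int.castAddHom ℤ_[p])
     map_zero' := by ext; simp
     map_add' := fun g g' ↦ by ext; simp [mul_add] }, fun g m ↦ rfl⟩

/-- **PONTRYAGIN BIDUALITY FOR `Λ = ℤ_p⟦T⟧` (evaluation form).**  Every additive `y : Λ^∨ → ℚ/ℤ` on the discrete dual is
«evaluate at `f`» for some `f ∈ Λ`: `y χ = χ f`.  Construction: for each `i`, the residues of `y` on the coefficient characters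
`g ↦ coeff_i(g) · m / p^k` (`m ∈ ℤ`, `k ≥ 0`; they lie in `Λ^∨`) form a character of the pairing subgroup of `Hom(ℤ, ℤ_p)`, hence are the
evaluation at some `w_i : ℤ → ℤ_p` (tree biduality `exists_eval_eq_of_character_padicPairingFamily`, `N = ℤ`); put `c_i := w_i(1)` and
`f := ∑ c_i T^i`.  A character `χ ∈ Λ^∨` killing `(T^n, p^k)` is the finite combination `∑_{i<n} b_i •` (coefficient character `(i, k)`)
with `χ(T^i) = b_i/p^k` (§2), and both `y χ` and `χ f` equal `∑ b_i c_i / p^k`. [cite: NeukirchSchmidtWingberg2008, I §1 (1.1.8)]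
[cite: Lang1990, Ch. 5 §1] -/
theorem exists_eq_eval_of_character_dualLambda
    (hQ : ∀ χ, χ ∈ Q ↔ ∃ n k : ℕ, (∀ f, χ (X ^ n * f) = 0) ∧ (∀ f, χ ((p : PowerSeries ℤ_[p]) ^ k * f) = 0))
    (y : Q →+ AddCircle (1 : ℚ)) :
    ∃ f : PowerSeries ℤ_[p], ∀ χ : Q, y χ = (χ : PowerSeries ℤ_[p] →+ AddCircle (1 : ℚ)) f := by
  -- the pairing family of `N = ℤ` and its subgroup `D`
  obtain ⟨e, he⟩ := exists_padicPairingFamily (N := ℤ) (p := p)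
  obtain ⟨D, hD⟩ := exists_addSubgroup_padicPairingFamily he
  -- coefficient functionals `α i : Λ → Hom(ℤ, ℤ_p)` and the pulled-back characters `d ∘ α i ∈ Q` for `d ∈ D`
  have hα : ∀ i : ℕ, ∃ α : PowerSeries ℤ_[p] →+ (ℤ →+ ℤ_[p]), ∀ (g : PowerSeries ℤ_[p]) (m : ℤ), α g m = m * coeff i g :=
    fun i ↦ exists_coeffFunctional i
  choose α hα using hα
  have hval : ∀ (i : ℕ) (m : ℤ) (k : ℕ) (g : PowerSeries ℤ_[p]),
      PadicInt.toZModPow k (α i g m) = (((m * ((PadicInt.toZModPow k (coeff i g)).val : ℤ)) : ℤ) : ZMod (p ^ k)) := by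
    intro i m k g
    rw [hα, map_mul, map_intCast, Int.cast_mul, Int.cast_natCast, ZMod.natCast_zmod_val]
  have he' : ∀ (i : ℕ) (m : ℤ) (k : ℕ) (g : PowerSeries ℤ_[p]),
      e m k (α i g) = ((((m * ((PadicInt.toZModPow k (coeff i g)).val : ℤ) : ℤ) : ℚ) / (p : ℚ) ^ k : ℚ) : AddCircle (1 : ℚ)) :=
    fun i m k g ↦ he m k (α i g) _ (hval i m k g)
  have hmemQ : ∀ (i : ℕ) (m : ℤ) (k : ℕ), (e m k).comp (α i) ∈ Q := by
    intro i m k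
    refine (hQ _).mpr ⟨i + 1, k, fun g ↦ ?_, fun g ↦ ?_⟩
    · have hzero : PadicInt.toZModPow k (coeff i (X ^ (i + 1) * g)) = 0 := by
        rw [coeff_X_pow_mul', if_neg (by omega), map_zero]
      rw [AddMonoidHom.comp_apply, he' i m k, hzero, ZMod.val_zero]
      simp
    · have hcoeff : coeff i ((p : PowerSeries ℤ_[p]) ^ k * g) = (p : ℤ_[p]) ^ k * coeff i g := by
        rw [← map_natCast (C (R := ℤ_[p])) p, ← map_pow, coeff_C_mul]
      have hzero : PadicInt.toZModPow k (coeff i ((p : PowerSeries ℤ_[p]) ^ k * g)) = 0 := by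
        rw [hcoeff, map_mul, map_pow, map_natCast, ← Nat.cast_pow, ZMod.natCast_self, zero_mul]
      rw [AddMonoidHom.comp_apply, he' i m k, hzero, ZMod.val_zero]
      simp
  -- for each `i`: the character `d ↦ y (d ∘ α i)` of `D` is an evaluation at some `w i : ℤ → ℤ_p`
  have hpull : ∀ i : ℕ, ∃ β : D →+ Q, ∀ (m : ℤ) (k : ℕ),
      ((β ⟨e m k, (hD _).mpr ⟨m, k, rfl⟩⟩ : Q) : PowerSeries ℤ_[p] →+ AddCircle (1 : ℚ)) = (e m k).comp (α i) := by
    intro i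
    have hmemD : ∀ d : D, (d : (ℤ →+ ℤ_[p]) →+ AddCircle (1 : ℚ)).comp (α i) ∈ Q := by
      rintro ⟨d, hd⟩
      obtain ⟨m, k, rfl⟩ := (hD d).mp hd
      exact hmemQ i m k
    exact ⟨{ toFun := fun d ↦ ⟨_, hmemD d⟩, map_zero' := Subtype.ext (by ext g; rfl),
             map_add' := fun d d' ↦ Subtype.ext (by ext g; rfl) }, fun m k ↦ rfl⟩
  choose β hβ using hpull
  have hw : ∀ i : ℕ, ∃ w : ℤ →+ ℤ_[p], ∀ d : D, y (β i d) = (d : (ℤ →+ ℤ_[p]) →+ AddCircle (1 : ℚ)) w :=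
    fun i ↦ exists_eval_eq_of_character_padicPairingFamily he hD (y.comp (β i))
  choose w hw using hw
  -- the power series
  refine ⟨mk fun i ↦ w i 1, fun χ ↦ ?_⟩
  obtain ⟨n, k, hn, hk⟩ := (hQ χ).mp χ.2
  -- integer numerators `b i` of `χ (T^i) = b_i / p^k`
  have hb : ∀ i : ℕ, ∃ b : ℤ, (χ : PowerSeries ℤ_[p] →+ AddCircle (1 : ℚ)) (X ^ i) =
      (((b : ℚ) / (p : ℚ) ^ k : ℚ) : AddCircle (1 : ℚ)) :=
    fun i ↦ Literature.NumberTheory.IwasawaTheory.QpModZp.addCircle_exists_eq_coe_int_div_of_nsmul_eq_zero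
      (nsmul_apply_eq_zero _ hk _)
  choose b hb using hb
  -- `χ = ∑_{i<n} b_i • (e 1 k ∘ α i)` as characters of `Λ`
  have hχsum : (χ : PowerSeries ℤ_[p] →+ AddCircle (1 : ℚ)) = ∑ i ∈ range n, b i • (e 1 k).comp (α i) := by
    ext g
    rw [apply_eq_sum_of_forall_X_pow_mul _ n hn g, AddMonoidHom.finsetSum_apply]
    refine Finset.sum_congr rfl fun i _ ↦ ?_
    rw [apply_C_mul_eq_val_nsmul _ hk, hb, AddMonoidHom.zsmul_apply, AddMonoidHom.comp_apply, he' i 1 k g, one_mul,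
      nsmul_coe_div_pow, zsmul_coe_div_pow, mul_comm]
  have hχsumQ : χ = ∑ i ∈ range n, b i • β i ⟨e 1 k, (hD _).mpr ⟨1, k, rfl⟩⟩ := by
    apply Subtype.ext
    rw [hχsum, AddSubgroup.val_finsetSum]
    refine Finset.sum_congr rfl fun i _ ↦ ?_
    rw [AddSubgroupClass.coe_zsmul, hβ]
  -- evaluate both sides
  have hyχ : y χ = ∑ i ∈ range n, b i • e 1 k (w i) := by
    rw [hχsumQ, map_sum]
    refine Finset.sum_congr rfl fun i _ ↦ ?_
    rw [map_zsmul, hw]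
  have hcoeff : ∀ i, coeff i (mk fun j ↦ w j 1 : PowerSeries ℤ_[p]) = w i 1 := fun i ↦ by rw [coeff_mk]
  rw [hyχ, apply_eq_sum_of_forall_X_pow_mul _ n hn]
  refine Finset.sum_congr rfl fun i _ ↦ ?_
  rw [apply_C_mul_eq_val_nsmul _ hk, hcoeff, hb, nsmul_coe_div_pow,
    he 1 k (w i) ((PadicInt.toZModPow k (w i 1)).val : ℤ) (by rw [Int.cast_natCast, ZMod.natCast_zmod_val]),
    zsmul_coe_div_pow, mul_comm]

/-! ### §4 `Hom(Λ^∨, ℚ/ℤ)` is cyclic, generated by «evaluate at 1» -/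

/-- **`f • ev₁ = ev_f`** for the `Λ`-structure `IsLocNil.module` on `Hom(Λ^∨, ℚ/ℤ)` (`T ↦ ∘ ψ`): the truncated action
`∑_{i<n} (coeff_i f mod p^k) • χ(T^i)` IS `χ(f)` for `χ` killing `(T^n, p^k)` (§2). [cite: GreenbergLNM1716, §1 p. 60] [cite: Lang1990, Ch. 5 §1] -/
theorem smul_evalOne_apply
    (hQ : ∀ χ, χ ∈ Q ↔ ∃ n k : ℕ, (∀ f, χ (X ^ n * f) = 0) ∧ (∀ f, χ ((p : PowerSeries ℤ_[p]) ^ k * f) = 0))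
    {ψ : AddMonoid.End Q}
    (hψ : ∀ χ : Q, ((ψ χ : Q) : PowerSeries ℤ_[p] →+ AddCircle (1 : ℚ)) =
      (χ : PowerSeries ℤ_[p] →+ AddCircle (1 : ℚ)).comp (AddMonoidHom.mulLeft X))
    (f : PowerSeries ℤ_[p]) (χ : Q) :
    letI := (isLocNil_dualLambda hQ hψ).module (A := AddCircle (1 : ℚ))
    (f • ((AddMonoidHom.eval (1 : PowerSeries ℤ_[p])).comp Q.subtype : Q →+ AddCircle (1 : ℚ))) χ =
      (χ : PowerSeries ℤ_[p] →+ AddCircle (1 : ℚ)) f := by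
  obtain ⟨n, k, hn, hk⟩ := (hQ χ).mp χ.2
  have hψn : (ψ ^ n) χ = 0 := Subtype.ext (by ext g; rw [coe_shift_pow_apply hψ, hn]; rfl)
  have hpk : p ^ k • χ = 0 := Subtype.ext (by
    ext g; rw [AddSubgroupClass.coe_nsmul, AddMonoidHom.nsmul_apply, nsmul_apply_eq_zero _ hk]; rfl)
  show (isLocNil_dualLambda hQ hψ).smulFun f _ χ = _
  rw [(isLocNil_dualLambda hQ hψ).smulFun_apply f _ hψn hpk, evalT_def, apply_eq_sum_of_forall_X_pow_mul _ n hn f]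
  refine Finset.sum_congr rfl fun i _ ↦ ?_
  rw [zpT_def]
  show (PadicInt.toZModPow k (coeff i f)).val • (((ψ ^ i) χ : Q) : PowerSeries ℤ_[p] →+ AddCircle (1 : ℚ)) 1 = _
  rw [coe_shift_pow_apply hψ, mul_one, apply_C_mul_eq_val_nsmul _ hk]

/-- **`Hom(Λ^∨, ℚ/ℤ)` is a CYCLIC `Λ`-module, generated by `ev₁ : χ ↦ χ(1)`** (biduality §3 + `f • ev₁ = ev_f` §4).
[cite: NeukirchSchmidtWingberg2008, I §1 (1.1.8)] [cite: KitajimaOtsuki2018, Prop. 3.32 (arXiv:1607.03612 p. 16)] -/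
theorem exists_cyclic_characterModule_dualLambda
    (hQ : ∀ χ, χ ∈ Q ↔ ∃ n k : ℕ, (∀ f, χ (X ^ n * f) = 0) ∧ (∀ f, χ ((p : PowerSeries ℤ_[p]) ^ k * f) = 0))
    {ψ : AddMonoid.End Q}
    (hψ : ∀ χ : Q, ((ψ χ : Q) : PowerSeries ℤ_[p] →+ AddCircle (1 : ℚ)) =
      (χ : PowerSeries ℤ_[p] →+ AddCircle (1 : ℚ)).comp (AddMonoidHom.mulLeft X)) :
    letI := (isLocNil_dualLambda hQ hψ).module (A := AddCircle (1 : ℚ))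
    ∃ y₀ : Q →+ AddCircle (1 : ℚ), ∀ y : Q →+ AddCircle (1 : ℚ), ∃ f : PowerSeries ℤ_[p], f • y₀ = y := by
  refine ⟨(AddMonoidHom.eval (1 : PowerSeries ℤ_[p])).comp Q.subtype, fun y ↦ ?_⟩
  obtain ⟨f, hf⟩ := exists_eq_eval_of_character_dualLambda hQ y
  refine ⟨f, ?_⟩
  ext χ
  rw [smul_evalOne_apply hQ hψ f χ, hf χ]

/-! ### §5 Transfer of cyclicity along equivariant injections -/

/-- **Cyclicity transfers along equivariant injections.**  `(S, ψ_S)`, `(Q, ψ_Q)` locally nilpotent, `j : S ↪ Q` additive injective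
with `j ∘ ψ_S = ψ_Q ∘ j`: if `Hom(Q, ℚ/ℤ)` is cyclic for `IsLocNil.module` then so is `Hom(S, ℚ/ℤ)` — every character of `S` extends
to `Q` (`ℚ/ℤ` injective: Mathlib `CharacterModule.dual_surjective_of_injective`) and restriction along `j` is `Λ`-linear.
[cite: GreenbergLNM1716, §1 p. 60] [cite: KitajimaOtsuki2018, (4.2) (arXiv:1607.03612 p. 19)] -/
theorem exists_cyclic_characterModule_of_injective {S : Type*} [AddCommGroup S] {ψS : AddMonoid.End S} (hS : IsLocNil p ψS)
    {Q' : Type*} [AddCommGroup Q'] {ψQ : AddMonoid.End Q'} (hQ' : IsLocNil p ψQ)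
    (j : S →+ Q') (hj : Function.Injective j) (hjψ : ∀ s, j (ψS s) = ψQ (j s))
    (hcyc : letI := hQ'.module (A := AddCircle (1 : ℚ));
      ∃ y₀ : Q' →+ AddCircle (1 : ℚ), ∀ y : Q' →+ AddCircle (1 : ℚ), ∃ f : PowerSeries ℤ_[p], f • y₀ = y) :
    letI := hS.module (A := AddCircle (1 : ℚ))
    ∃ x₀ : S →+ AddCircle (1 : ℚ), ∀ x : S →+ AddCircle (1 : ℚ), ∃ f : PowerSeries ℤ_[p], f • x₀ = x := by
  obtain ⟨y₀, hy₀⟩ := hcyc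
  refine ⟨y₀.comp j, fun x ↦ ?_⟩
  -- extend `x` along `j`
  obtain ⟨y, hy⟩ := CharacterModule.dual_surjective_of_injective (R := ℤ) j.toIntLinearMap hj x
  obtain ⟨f, rfl⟩ := hy₀ y
  refine ⟨f, ?_⟩
  have hyx : ∀ s, (letI := hQ'.module (A := AddCircle (1 : ℚ)); (f • y₀) (j s)) = x s := fun s ↦ by
    rw [← hy]; rfl
  ext s
  rw [← hyx s]
  -- both sides are the truncated sums, transported along `j`
  obtain ⟨N, hN⟩ := hS.nil s
  obtain ⟨k, hk⟩ := hS.torsion s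
  have hpow : ∀ i, j ((ψS ^ i) s) = (ψQ ^ i) (j s) := by
    intro i
    induction i with
    | zero => rfl
    | succ i ih =>
      rw [pow_succ', pow_succ', AddMonoid.End.coe_mul, AddMonoid.End.coe_mul, Function.comp_apply, Function.comp_apply, hjψ, ih]
  have hN' : (ψQ ^ N) (j s) = 0 := by rw [← hpow, hN, map_zero]
  have hk' : p ^ k • j s = 0 := by rw [← map_nsmul, hk, map_zero]
  show hS.smulFun f (y₀.comp j) s = hQ'.smulFun f y₀ (j s)
  rw [hS.smulFun_apply f _ hN hk, hQ'.smulFun_apply f _ hN' hk', evalT_def, evalT_def]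
  refine Finset.sum_congr rfl fun i _ ↦ ?_
  rw [AddMonoidHom.comp_apply, hpow]

end LambdaDual

end OddBlindNF

end Summit.BirchSwinnertonDyer.BirchSwinnertonDyer.Theorems

end
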